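import Literature.NumberTheory.Automorphic.UnitaryLatticeTreeLevelShiftClass        -- ★ T4′-GEN (F0P2-p01): `isIntMatrix_add∕sub∕smul_of_v_le_one∕one`; brings ★ `isIntMatrix_mul∕pow`, `IsIntMatrix`, `UnramifiedLocalConjDatum`
import Literature.NumberTheory.Automorphic.UnitaryThreeRegularUnipotentClass         -- ★ p08 (g16∕g17): `n(t)`, `d(z)`, `u(a,b)` in `U(σ, J₀)`, `coe_torusElt_conj_cornerUnipotent`, `exists_units_coe_eq_upperTriangularUnipotent`
import HarnessLib

/-!
# Level-two congruence bookkeeping in the hyperspecial unitary group in three variables (Rogawski 1990, §1.10, §3.9; Tits 1979, §3.5)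

Topic `NumberTheory/Automorphic`; namespace `Literature.NumberTheory.Automorphic.UnitaryGroup` (= ★ `UnitaryThreeSingularUnipotentClasses`).  THEOREMS ONLY (no definition,
no instance, no notation, no named fact, no `sorry`).  Cell `pub/hodgecm-mathlib`, road «S3-tree», crux H413 = `stmt-HodgeConjecture-24833`; architect A-p16 (g29) A-83
«RIGID-2» (boundary rigidity at level 2), hand F0P3-p03 (g13); file (A1) = the bookkeeping used by (A2) `UnitaryThreeLevelTwoHeisenbergClasses` and (B) `UnitaryThreeBoundaryRigidityLevelTwo`.

SETTING.  `K` a valued field (`Valued K ℤᵐ⁰`) with ★ `UnramifiedLocalConjDatum σ ϖ` (involution `σ` preserving `v`, `σ`-fixed uniformiser `ϖ`, trace and norm properties of an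
unramified quadratic extension), `v 2 = 1`; `J₀ = antidiag(1,1,1)`, `U = U(σ, J₀) =` ★ `unitaryGroupOfForm σ ((StdForm.antidiagonal 3).over K)`, `K₀ = U ∩ GL₃(𝒪)` (integral with
integral inverse); «`A ≡ B (mod ϖ²)`» is the token ★ `IsIntMatrix ((ϖ ^ 2)⁻¹ • (A − B))`.  Rogawski's Heisenberg elements `u(α, β) = (1, α, β; 0, 1, −σα; 0, 0, 1)` (★ p08
`mem_unitaryGroupOfForm_iff_of_coe_eq_upperUnipotent`), singular ones `n(t) = u(0, t)`.

* §1 Valuation and congruence bookkeeping: `v_inv_mul_le_one_iff`, `isIntMatrix_inv_smul_iff`, **`isIntMatrix_smul_conj_sub`** (conjugating a congruence by `K₀`),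
  `isIntMatrix_of_near_upperUnipotent`, **`v_trace_corner_le_of_near_upperUnipotent`** (unitarity of `x ≡ (1, α, β; 0, 1, c; 0, 0, 1)` forces `β + σβ + σc·c ≡ 0 (mod ϖ²)`).
* §2 Unitriangular units: `exists_units_coe_eq_lowerUnipotent` (the upper one is ★ `exists_units_coe_eq_upperTriangularUnipotent`), `mem_unitaryGroupOfForm_of_coe_eq_lowerUnipotent`, **`exists_norm_eq_of_residual`**
  (a `σ`-fixed unit is an exact norm `z σz` under `hd.norm` + residual norm surjectivity), `ϖ_facts`, `v_le_ϖ_of_lt_one`.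
HONEST LABEL: HC_CM is proved only modulo the printed citations (2 remaining named inputs hLiu418, h413) until rung 0 closes; this file is elementary matrix algebra over a valued field.

## References
* [Rogawski1990] J. D. Rogawski, *Automorphic Representations of Unitary Groups in Three Variables*, Ann. of Math. Stud. 123 (1990): §1.10 p. 9, §3.9 p. 32, Prop. 3.9.1.
* [Tits1979] J. Tits, *Reductive groups over local fields*, Proc. Sympos. Pure Math. 33.1 (1979): §3.3.3 (hyperspecial `K₀`), §3.5 (congruence filtration).
* [Serre1979] J.-P. Serre, *Local Fields*, GTM 67 (1979): Ch. V §2 Prop. 3 (norms in unramified extensions).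
-/

set_option autoImplicit false

open Matrix
open scoped Valued WithZero Matrix MatrixGroups

namespace Literature.NumberTheory.Automorphic.UnitaryGroup

open Literature.NumberTheory.Automorphic Literature.NumberTheory.Automorphic.HermitianLattice Literature.NumberTheory.Automorphic.UnitaryLatticeTree

variable {K : Type*} [Field K] [Valued K ℤᵐ⁰]

/-! ## §1 Valuation and congruence bookkeeping -/

/-- `v (c⁻¹ x) ≤ 1 ↔ v x ≤ v c` for `c ≠ 0`. [cite: Tits1979, §3.5] -/
theorem v_inv_mul_le_one_iff {c : K} (hc : c ≠ 0) (x : K) : Valued.v (c⁻¹ * x) ≤ 1 ↔ Valued.v x ≤ Valued.v c := by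
  have hc' : Valued.v c ≠ 0 := (Valuation.ne_zero_iff _).2 hc
  rw [map_mul, map_inv₀, ← div_eq_inv_mul, div_le_one₀ (zero_lt_iff.2 hc')]

/-- `c⁻¹ • E` is integral iff every entry of `E` has valuation `≤ v c`. [cite: Tits1979, §3.5] -/
theorem isIntMatrix_inv_smul_iff {N : ℕ} {c : K} (hc : c ≠ 0) (E : Matrix (Fin N) (Fin N) K) :
    IsIntMatrix (c⁻¹ • E) ↔ ∀ i j, Valued.v (E i j) ≤ Valued.v c := by
  simp only [IsIntMatrix, Matrix.smul_apply, smul_eq_mul, v_inv_mul_le_one_iff hc]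

/-- **Conjugating a congruence by `K₀`**: if `x ≡ U (mod c)` and `k U k′ ≡ T (mod c)` with `k, k′` integral, then `k x k′ ≡ T (mod c)`. [cite: Tits1979, §3.5] -/
theorem isIntMatrix_smul_conj_sub {N : ℕ} (c : K) {k k' x U T : Matrix (Fin N) (Fin N) K} (hk : IsIntMatrix k) (hk' : IsIntMatrix k')
    (hx : IsIntMatrix (c • (x - U))) (hE : IsIntMatrix (c • (k * U * k' - T))) : IsIntMatrix (c • (k * x * k' - T)) := by
  have h : c • (k * x * k' - T) = k * (c • (x - U)) * k' + c • (k * U * k' - T) := by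
    rw [Matrix.mul_smul, Matrix.smul_mul, ← smul_add]
    congr 1
    simp only [Matrix.mul_sub, Matrix.sub_mul]
    abel
  rw [h]
  exact isIntMatrix_add (isIntMatrix_mul (isIntMatrix_mul hk hx) hk') hE

/-- An element congruent mod `c` (`v c ≤ 1`) to an integral matrix is integral. [cite: Tits1979, §3.5] -/
theorem isIntMatrix_of_isIntMatrix_inv_smul_sub {N : ℕ} {c : K} (hc : c ≠ 0) (hcv : Valued.v c ≤ 1) {x U : Matrix (Fin N) (Fin N) K}
    (hU : IsIntMatrix U) (hx : IsIntMatrix (c⁻¹ • (x - U))) : IsIntMatrix x := by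
  have h : x = U + c • (c⁻¹ • (x - U)) := by rw [smul_smul, mul_inv_cancel₀ hc, one_smul, add_sub_cancel]
  rw [h]
  exact isIntMatrix_add hU (isIntMatrix_smul_of_v_le_one hcv hx)

/-- The upper unitriangular matrix `(1, a, b; 0, 1, c; 0, 0, 1)` with integral `a, b, c` is integral. [cite: Tits1979, §3.3.3] -/
theorem isIntMatrix_upperUnipotent {a b c : K} (ha : Valued.v a ≤ 1) (hb : Valued.v b ≤ 1) (hc : Valued.v c ≤ 1) :
    IsIntMatrix (!![1, a, b; 0, 1, c; 0, 0, 1] : Matrix (Fin 3) (Fin 3) K) := by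
  intro i j
  fin_cases i <;> fin_cases j <;> simp [ha, hb, hc]

/-- The lower unitriangular matrix `(1, 0, 0; a, 1, 0; b, c, 1)` with integral `a, b, c` is integral. [cite: Tits1979, §3.3.3] -/
theorem isIntMatrix_lowerUnipotent {a b c : K} (ha : Valued.v a ≤ 1) (hb : Valued.v b ≤ 1) (hc : Valued.v c ≤ 1) :
    IsIntMatrix (!![1, 0, 0; a, 1, 0; b, c, 1] : Matrix (Fin 3) (Fin 3) K) := by
  intro i j
  fin_cases i <;> fin_cases j <;> simp [ha, hb, hc]

/-- A diagonal matrix with integral entries is integral. [cite: Tits1979, §3.3.3] -/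
theorem isIntMatrix_diagonal_three {a b c : K} (ha : Valued.v a ≤ 1) (hb : Valued.v b ≤ 1) (hc : Valued.v c ≤ 1) :
    IsIntMatrix (Matrix.diagonal ![a, b, c] : Matrix (Fin 3) (Fin 3) K) := by
  intro i j
  fin_cases i <;> fin_cases j <;> simp [Matrix.diagonal, ha, hb, hc]

/-- Ultrametric bookkeeping: `v (a + b) ≤ P` from `v a ≤ P`, `v b ≤ P`. [cite: Serre1979, Ch. II §1] -/
theorem v_add_le_of_le {a b : K} {P : ℤᵐ⁰} (ha : Valued.v a ≤ P) (hb : Valued.v b ≤ P) : Valued.v (a + b) ≤ P :=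
  (Valuation.map_add _ _ _).trans (max_le ha hb)

/-- Ultrametric bookkeeping: `v (a − b) ≤ P` from `v a ≤ P`, `v b ≤ P`. [cite: Serre1979, Ch. II §1] -/
theorem v_sub_le_of_le {a b : K} {P : ℤᵐ⁰} (ha : Valued.v a ≤ P) (hb : Valued.v b ≤ P) : Valued.v (a - b) ≤ P :=
  (Valuation.map_sub _ _ _).trans (max_le ha hb)

/-- Bookkeeping: `v (a · b) ≤ P` from `v a ≤ P`, `v b ≤ 1`. [cite: Serre1979, Ch. II §1] -/
theorem v_mul_le_of_le_of_le_one {a b : K} {P : ℤᵐ⁰} (ha : Valued.v a ≤ P) (hb : Valued.v b ≤ 1) : Valued.v (a * b) ≤ P := by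
  rw [map_mul]; exact (mul_le_mul' ha hb).trans_eq (mul_one P)

/-- Bookkeeping: `v (a · b) ≤ P` from `v a ≤ 1`, `v b ≤ P`. [cite: Serre1979, Ch. II §1] -/
theorem v_mul_le_of_le_one_of_le {a b : K} {P : ℤᵐ⁰} (ha : Valued.v a ≤ 1) (hb : Valued.v b ≤ P) : Valued.v (a * b) ≤ P := by
  rw [map_mul]; exact (mul_le_mul' ha hb).trans_eq (one_mul P)

/-- Bookkeeping: `v (a · b) ≤ P · Q` from `v a ≤ P`, `v b ≤ Q`. [cite: Serre1979, Ch. II §1] -/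
theorem v_mul_le_mul {a b : K} {P Q : ℤᵐ⁰} (ha : Valued.v a ≤ P) (hb : Valued.v b ≤ Q) : Valued.v (a * b) ≤ P * Q := by
  rw [map_mul]; exact mul_le_mul' ha hb

/-- **Unitarity of a near-upper-unitriangular element at level two**: if `x ∈ U(σ, J₀)` and `x ≡ (1, α, β; 0, 1, c; 0, 0, 1) (mod ϖ²)` with `α, β, c` integral, then
`β + σβ + σc·c ≡ 0 (mod ϖ²)` (the `(e₂, e₂)` entry of `σxᵀ J₀ x = J₀`). [cite: Rogawski1990, §1.10 p. 9] -/
theorem v_corner_trace_le_of_near_upperUnipotent {σ : K →+* K} {ϖ : K} (hd : UnramifiedLocalConjDatum σ ϖ)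
    {x : GL (Fin 3) K} (hxU : x ∈ unitaryGroupOfForm σ ((StdForm.antidiagonal 3).over K)) {α β c : K} (hβ : Valued.v β ≤ 1) (hc : Valued.v c ≤ 1)
    (hx : IsIntMatrix ((ϖ ^ 2)⁻¹ • ((x : Matrix (Fin 3) (Fin 3) K) - !![1, α, β; 0, 1, c; 0, 0, 1]))) :
    Valued.v (β + σ β + σ c * c) ≤ Valued.v (ϖ ^ 2) := by
  have hϖ2 : (ϖ ^ 2 : K) ≠ 0 := pow_ne_zero _ hd.ϖ_ne_zero
  have hP1 : Valued.v (ϖ ^ 2) ≤ 1 := by rw [map_pow]; exact pow_le_one₀ zero_le (by rw [hd.vϖ, ← WithZero.exp_zero]; exact WithZero.exp_le_exp.2 (by norm_num))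
  rw [isIntMatrix_inv_smul_iff hϖ2] at hx
  -- the entries of column `2` of `x`
  obtain ⟨τ, hτ⟩ : ∃ τ : Matrix (Fin 3) (Fin 3) K, (x : Matrix (Fin 3) (Fin 3) K) - !![1, α, β; 0, 1, c; 0, 0, 1] = τ := ⟨_, rfl⟩
  rw [hτ] at hx
  have hxe : ∀ i j, (x : Matrix (Fin 3) (Fin 3) K) i j = !![1, α, β; 0, 1, c; 0, 0, 1] i j + τ i j := fun i j => by
    rw [← hτ, Matrix.sub_apply]; ring
  have h02 : (x : Matrix (Fin 3) (Fin 3) K) 0 2 = β + τ 0 2 := by rw [hxe]; rfl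
  have h12 : (x : Matrix (Fin 3) (Fin 3) K) 1 2 = c + τ 1 2 := by rw [hxe]; rfl
  have h22 : (x : Matrix (Fin 3) (Fin 3) K) 2 2 = 1 + τ 2 2 := by rw [hxe]; rfl
  -- `B₀(x e₂, x e₂) = B₀(e₂, e₂) = 0`
  have hcol : (x : Matrix (Fin 3) (Fin 3) K) *ᵥ (Pi.single 2 1 : Fin 3 → K) = ![β + τ 0 2, c + τ 1 2, 1 + τ 2 2] := by
    rw [← h02, ← h12, ← h22]
    funext i; fin_cases i <;> simp [Matrix.mulVec, dotProduct, Pi.single_apply]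
  have hR : B₀ σ 3 (Pi.single 2 1 : Fin 3 → K) (Pi.single 2 1) = 0 := by rw [B₀_three_apply]; simp
  have hiso := (mem_unitaryGroupOfForm_antidiagonal_iff x).1 hxU (Pi.single 2 1) (Pi.single 2 1)
  rw [hcol, hR, B₀_three_apply] at hiso
  have e0 : (![β + τ 0 2, c + τ 1 2, 1 + τ 2 2] : Fin 3 → K) 0 = β + τ 0 2 := rfl
  have e1 : (![β + τ 0 2, c + τ 1 2, 1 + τ 2 2] : Fin 3 → K) 1 = c + τ 1 2 := rfl
  have e2 : (![β + τ 0 2, c + τ 1 2, 1 + τ 2 2] : Fin 3 → K) 2 = 1 + τ 2 2 := rfl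
  rw [e0, e1, e2] at hiso
  -- `hiso : σ(β + τ₀₂)(1 + τ₂₂) + σ(c + τ₁₂)(c + τ₁₂) + σ(1 + τ₂₂)(β + τ₀₂) = 0`
  have key : β + σ β + σ c * c = -(σ β * τ 2 2 + σ (τ 0 2) * (1 + τ 2 2) + σ c * τ 1 2 + σ (τ 1 2) * (c + τ 1 2) + τ 0 2 + σ (τ 2 2) * (β + τ 0 2)) := by
    simp only [map_add, map_one] at hiso
    linear_combination hiso
  rw [key, Valuation.map_neg]
  have hσv : ∀ z, Valued.v (σ z) = Valued.v z := hd.vσ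
  have i02 : Valued.v (1 + τ 2 2) ≤ 1 := v_add_le_of_le (by rw [map_one]) ((hx 2 2).trans hP1)
  have ic : Valued.v (c + τ 1 2) ≤ 1 := v_add_le_of_le hc ((hx 1 2).trans hP1)
  have ib : Valued.v (β + τ 0 2) ≤ 1 := v_add_le_of_le hβ ((hx 0 2).trans hP1)
  refine v_add_le_of_le (v_add_le_of_le (v_add_le_of_le (v_add_le_of_le (v_add_le_of_le ?_ ?_) ?_) ?_) (hx 0 2)) ?_
  · exact v_mul_le_of_le_one_of_le (by rw [hσv]; exact hβ) (hx 2 2)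
  · exact v_mul_le_of_le_of_le_one (by rw [hσv]; exact hx 0 2) i02
  · exact v_mul_le_of_le_one_of_le (by rw [hσv]; exact hc) (hx 1 2)
  · exact v_mul_le_of_le_of_le_one (by rw [hσv]; exact hx 1 2) ic
  · exact v_mul_le_of_le_of_le_one (by rw [hσv]; exact hx 2 2) ib

/-! ## §2 Unitriangular units and exact norms -/

omit [Valued K ℤᵐ⁰] in
/-- The lower unitriangular `(1, 0, 0; a, 1, 0; b, c, 1)` as a unit, with inverse `(1, 0, 0; −a, 1, 0; ac − b, −c, 1)`. [cite: Rogawski1990, §1.10 p. 9] -/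
theorem exists_units_coe_eq_lowerUnipotent (a b c : K) :
    ∃ u : GL (Fin 3) K, (u : Matrix (Fin 3) (Fin 3) K) = !![1, 0, 0; a, 1, 0; b, c, 1] ∧
      ((u⁻¹ : GL (Fin 3) K) : Matrix (Fin 3) (Fin 3) K) = !![1, 0, 0; -a, 1, 0; a * c - b, -c, 1] := by
  have h1 : (!![1, 0, 0; a, 1, 0; b, c, 1] : Matrix (Fin 3) (Fin 3) K) * !![1, 0, 0; -a, 1, 0; a * c - b, -c, 1] = 1 := by
    ext i j; fin_cases i <;> fin_cases j <;> (simp [Matrix.mul_apply, Fin.sum_univ_three]; try ring)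
  have h2 : (!![1, 0, 0; -a, 1, 0; a * c - b, -c, 1] : Matrix (Fin 3) (Fin 3) K) * !![1, 0, 0; a, 1, 0; b, c, 1] = 1 := by
    ext i j; fin_cases i <;> fin_cases j <;> (simp [Matrix.mul_apply, Fin.sum_univ_three]; try ring)
  exact ⟨⟨_, _, h1, h2⟩, rfl, rfl⟩

omit [Valued K ℤᵐ⁰] in
/-- The action of a lower unitriangular matrix on coordinates. [cite: Rogawski1990, §1.10 p. 9] -/
theorem lowerUnipotent_mulVec (a b c : K) (x : Fin 3 → K) :
    (!![1, 0, 0; a, 1, 0; b, c, 1] : Matrix (Fin 3) (Fin 3) K).mulVec x 0 = x 0 ∧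
      (!![1, 0, 0; a, 1, 0; b, c, 1] : Matrix (Fin 3) (Fin 3) K).mulVec x 1 = a * x 0 + x 1 ∧
      (!![1, 0, 0; a, 1, 0; b, c, 1] : Matrix (Fin 3) (Fin 3) K).mulVec x 2 = b * x 0 + c * x 1 + x 2 := by
  refine ⟨?_, ?_, ?_⟩ <;> simp [Matrix.mulVec, dotProduct, Fin.sum_univ_three]

omit [Valued K ℤᵐ⁰] in
/-- **Lower Heisenberg elements are unitary**: `(1, 0, 0; a, 1, 0; b, −σa, 1) ∈ U(σ, J₀)` when `b + σb + a·σa = 0` (the transpose picture of ★ p08's `u(a, b)`).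
[cite: Rogawski1990, §1.10 p. 9] -/
theorem mem_unitaryGroupOfForm_of_coe_eq_lowerUnipotent {σ : K →+* K} (hσ : ∀ z : K, σ (σ z) = z) {a b c : K} {u : GL (Fin 3) K}
    (hu : (u : Matrix (Fin 3) (Fin 3) K) = !![1, 0, 0; a, 1, 0; b, c, 1]) (hc : c = -σ a) (hb : b + σ b + a * σ a = 0) :
    u ∈ unitaryGroupOfForm σ ((StdForm.antidiagonal 3).over K) := by
  rw [mem_unitaryGroupOfForm_antidiagonal_iff, hu]
  intro x y
  obtain ⟨hx0, hx1, hx2⟩ := lowerUnipotent_mulVec a b c x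
  obtain ⟨hy0, hy1, hy2⟩ := lowerUnipotent_mulVec a b c y
  rw [B₀_three_apply, B₀_three_apply, hx0, hx1, hx2, hy0, hy1, hy2]
  simp only [map_add, map_mul, hc, map_neg, hσ]
  have hb' : σ b = -b - a * σ a := by linear_combination hb
  rw [hb']
  ring

/-- **Exact norms from residual ones**: under `UnramifiedLocalConjDatum` (1-units are norms) and residual norm surjectivity `hN`, every `σ`-fixed unit `u` is a norm `z·σz`
of a unit `z`. [cite: Serre1979, Ch. V §2 Prop. 3] -/
theorem exists_norm_eq_of_residual {σ : K →+* K} {ϖ : K} (hd : UnramifiedLocalConjDatum σ ϖ)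
    (hN : ∀ u : K, σ u = u → Valued.v u = 1 → ∃ z : K, Valued.v (z * σ z - u) < 1) {u : K} (hσu : σ u = u) (hu : Valued.v u = 1) :
    ∃ z : K, z * σ z = u ∧ Valued.v z = 1 := by
  obtain ⟨z₁, hz₁⟩ := hN u hσu hu
  have hn1 : Valued.v (z₁ * σ z₁) = 1 := by
    have h := Valuation.map_eq_of_sub_lt Valued.v (x := u) (y := z₁ * σ z₁) (by rwa [hu])
    rw [h, hu]
  have hn0 : z₁ * σ z₁ ≠ 0 := fun h => by rw [h, map_zero] at hn1; exact zero_ne_one hn1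
  -- `u' = u / (z₁ σz₁)` is a `σ`-fixed `1`-unit
  have hσu' : σ (u / (z₁ * σ z₁)) = u / (z₁ * σ z₁) := by rw [map_div₀, map_mul, hd.σσ, hσu, mul_comm (σ z₁)]
  have hu'1 : Valued.v (u / (z₁ * σ z₁) - 1) < 1 := by
    rw [div_sub_one hn0, map_div₀, hn1, div_one, ← Valuation.map_neg, neg_sub]; exact hz₁
  obtain ⟨z₂, hz₂, -⟩ := hd.norm _ hσu' hu'1
  have hzu : z₁ * z₂ * σ (z₁ * z₂) = u := by rw [map_mul, mul_mul_mul_comm, hz₂, mul_div_cancel₀ _ hn0]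
  refine ⟨z₁ * z₂, hzu, ?_⟩
  have h : Valued.v (z₁ * z₂) * Valued.v (z₁ * z₂) = 1 := by
    conv_rhs => rw [← hu, ← hzu]
    rw [Valuation.map_mul Valued.v (z₁ * z₂), hd.vσ]
  have ha0 : Valued.v (z₁ * z₂) ≠ 0 := fun h0 => by rw [h0, zero_mul] at h; exact zero_ne_one h
  rw [← WithZero.exp_log ha0, ← WithZero.exp_add, ← WithZero.exp_zero, WithZero.exp_inj] at h
  rw [← WithZero.exp_log ha0, ← WithZero.exp_zero, WithZero.exp_inj]
  omega

/-- Basic facts on `ϖ` under the datum: `ϖ ≠ 0`, `ϖ² ≠ 0`, `v ϖ < 1`, `v ϖ² ≤ 1`, `v ϖ² = v ϖ · v ϖ`. [cite: Tits1979, §3.5] -/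
theorem ϖ_facts {σ : K →+* K} {ϖ : K} (hd : UnramifiedLocalConjDatum σ ϖ) :
    ϖ ≠ 0 ∧ (ϖ ^ 2 : K) ≠ 0 ∧ Valued.v ϖ < 1 ∧ Valued.v (ϖ ^ 2) ≤ 1 ∧ Valued.v (ϖ ^ 2) = Valued.v ϖ * Valued.v ϖ := by
  have h1 : Valued.v ϖ < 1 := by rw [hd.vϖ, ← WithZero.exp_zero]; exact WithZero.exp_lt_exp.2 (by norm_num)
  refine ⟨hd.ϖ_ne_zero, pow_ne_zero _ hd.ϖ_ne_zero, h1, ?_, by rw [map_pow, sq]⟩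
  rw [map_pow]; exact pow_le_one₀ zero_le h1.le

/-- `v x ≤ 1` and `¬ v x < 1` give `v x = 1`; `v x < 1` gives `v x ≤ v ϖ`. [cite: Tits1979, §3.5] -/
theorem v_le_ϖ_of_lt_one {σ : K →+* K} {ϖ : K} (hd : UnramifiedLocalConjDatum σ ϖ) {x : K} (hx : Valued.v x < 1) :
    Valued.v x ≤ Valued.v ϖ := by
  rw [hd.vϖ]; exact (v_lt_one_iff x).1 hx

end Literature.NumberTheory.Automorphic.UnitaryGroup
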